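import Summits.KontsevichZagierPeriods.Zeta5Search.RecurrenceCertificateDecay
import Summits.KontsevichZagierPeriods.Zeta5Search.CalibrationAperyRates
import HarnessLib

/-!
# ζ(5) search — calibration: the EXACT decay of Apéry's forms `bₙζ(3) - aₙ` (cell `pub-zeta5`, TYPER)

HONEST FRAMING: systematic search; no irrationality claim unless certified.

`RecurrenceCertificateDecay.lean` (exact decay for FORMAT A′) instantiated on the Apéry calibration
certificate with its Poincaré data `aperyLimitData` (`CalibrationAperyRates.lean`: `λ∞ = 17 + 12√2`,
`b = 1`). PROVED (0 sorry), for Apéry's numbers `bₙ = q_{n,n}`, `aₙ = p_{n,n}` of the tree's table: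

* `apery_form_ne_zero` — `bₙζ(3) - aₙ ≠ 0` (`n ≥ 62`, the certificate's threshold; from the squeeze);
* `tendsto_log_abs_apery_sub_div` — `log|ζ(3) - aₙ/bₙ|/n → -2 log(17+12√2)`;
* `tendsto_log_abs_apery_form_div` — `log|bₙζ(3) - aₙ|/n → -log(17+12√2) = -3.52549…`;
* `tendsto_root_abs_apery_form` — `|bₙζ(3) - aₙ|^{1/n} → (√2-1)⁴ = 0.029437…`:
  the classical Apéry decay, as exact limits (growth side: `CalibrationAperyRates.tendsto_root_qT`).
-/

noncomputable section

open Filter Topology Finset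
open Literature.NumberTheory.Transcendental
open Literature.NumberTheory.Transcendental.Apery

namespace Summit.KontsevichZagierPeriods.Zeta5Search

namespace CalibrationAperyRecurrence

/-- `(√2-1)⁴ = (17+12√2)⁻¹` (`(√2-1)(√2+1) = 1`). -/
theorem sqrt_two_sub_one_pow_four : (Real.sqrt 2 - 1) ^ 4 = (17 + 12 * Real.sqrt 2)⁻¹ := by
  have hs : Real.sqrt 2 ^ 2 = 2 := Real.sq_sqrt (by norm_num)
  rw [← one_add_sqrt_two_pow_four, ← inv_pow]
  congr 1
  refine eq_inv_of_mul_eq_one_left ?_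
  linear_combination hs

/-- **Apéry's forms do not vanish** (from the certificate's threshold `n ≥ 62` on):
`bₙζ(3) - aₙ ≠ 0`. -/
theorem apery_form_ne_zero (n : ℕ) (hn : 62 ≤ n) : (qT n n : ℝ) * zetaValue 3 - pT n n ≠ 0 :=
  aperyRecurrenceCertificate.form_ne_zero n hn

/-- **Exact approximation rate**: `log|ζ(3) - aₙ/bₙ|/n → -2 log(17+12√2)`. -/
theorem tendsto_log_abs_apery_sub_div :
    Tendsto (fun n : ℕ => Real.log |zetaValue 3 - (pT n n : ℝ) / qT n n| / n) atTop
      (𝓝 (-2 * Real.log (17 + 12 * Real.sqrt 2))) := by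
  have h := aperyLimitData.tendsto_log_abs_err_div (by norm_num [aperyLimitData])
  have e : Real.log aperyLimitData.b - 2 * Real.log aperyLimitData.lam =
      -2 * Real.log (17 + 12 * Real.sqrt 2) := by
    simp [aperyLimitData]
  rw [e] at h
  exact h

/-- **Exact decay of Apéry's forms**: `log|bₙζ(3) - aₙ|/n → -log(17+12√2) = -3.52549…`. -/
theorem tendsto_log_abs_apery_form_div :
    Tendsto (fun n : ℕ => Real.log |(qT n n : ℝ) * zetaValue 3 - pT n n| / n) atTop
      (𝓝 (-Real.log (17 + 12 * Real.sqrt 2))) := by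
  have h := aperyLimitData.tendsto_log_abs_form_div (by norm_num [aperyLimitData])
  have e : Real.log aperyLimitData.b - Real.log aperyLimitData.lam =
      -Real.log (17 + 12 * Real.sqrt 2) := by
    simp [aperyLimitData]
  rw [e] at h
  exact h

/-- **`|bₙζ(3) - aₙ|^{1/n} → (√2-1)⁴`**. -/
theorem tendsto_root_abs_apery_form :
    Tendsto (fun n : ℕ => |(qT n n : ℝ) * zetaValue 3 - pT n n| ^ (1 / (n : ℝ))) atTop
      (𝓝 ((Real.sqrt 2 - 1) ^ 4)) := by
  have h := aperyLimitData.tendsto_root_abs_form (by norm_num [aperyLimitData])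
  have e : aperyLimitData.b / aperyLimitData.lam = (Real.sqrt 2 - 1) ^ 4 := by
    rw [sqrt_two_sub_one_pow_four]
    simp [aperyLimitData]
  rw [e] at h
  exact h

end CalibrationAperyRecurrence

end Summit.KontsevichZagierPeriods.Zeta5Search
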